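import Mathlib.AlgebraicGeometry.AlgClosed.Basic
import Mathlib.AlgebraicGeometry.PullbackCarrier
import Mathlib.RingTheory.Flat.Localization
import Literature.NumberTheory.DiophantineGeometry.AVIsogenyTateProofs
import HarnessLib

/-!
# Discharged fact: isogenous abelian varieties have isomorphic rational Tate modules

Sibling proof file of `Literature/NumberTheory/DiophantineGeometry/AVIsogenyTate.lean`, which
records as a named fact

* `Literature.AlgebraicGeometry.Motives.AbelianVariety.nonempty_equiv_rationalTateRep_of_isIsogenous :
  Prop` — for abelian varieties `A, B` over a field `K`: if `A` and `B` are isogenous then, for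
  every prime `ℓ`, `V_ℓ A ≅ V_ℓ B` as `ℚ_ℓ[Γ_K]`-modules (`Nonempty` of a Mathlib
  `Representation.Equiv` between `A.rationalTateRep ℓ` and `B.rationalTateRep ℓ`); Tate 1966, §1
  (`V_ℓ` is a functor of the isogeny category), Mumford, *Abelian Varieties*, §19, p. 172
  ("`V_ℓ f` is an isomorphism for an isogeny `f`");

proved here as
`Literature.AlgebraicGeometry.Motives.AbelianVariety.nonempty_equiv_rationalTateRep_of_isIsogenous_holds`
(stated, as the other discharges of facts with implicit arguments in this directory, with the
named arguments `(A := A) (B := B)`).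

## Proof

We do **not** go through a quasi-inverse `g` of the isogeny (`g ∘ f = [n]`, Mumford §19 Remark
p. 169 — that is the undischarged named fact `IsIsogeny.exists_nsmul_inverse`), but argue on
points, as in Milne, *Abelian Varieties* (1986), §8 and the proof of Prop. 16.8 (PDF p. 204 of the
held Cornell–Silverman volume: "for `b ∈ T_ℓ B` there is `a ∈ T_ℓ A` with `ℓ^m b = f(a)`"):
for an isogeny `f : A ⟶ B` (a finite surjective homomorphism) and `K̄` an algebraic closure,

1. `f : A(K̄) → B(K̄)` is **surjective** (`IsIsogeny.geomPointsMap_surjective`): the fibre of the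
   finite surjective morphism of schemes underlying `f` over a `K̄`-point of `B` is a non-empty
   scheme finite over `Spec K̄`, so it has a closed point, which is `K̄`-rational by the
   Nullstellensatz (Mathlib `AlgebraicGeometry.pointOfClosedPoint`); this is the scheme-theoretic
   lemma `exists_specHom_comp_eq_of_isFinite` below, valid for any finite surjective morphism and
   any algebraically closed field;
2. `ker (A(K̄) → B(K̄))` is **finite** (`IsIsogeny.finite_ker_geomPointsMap`, sibling file
   `AVIsogenyTateProofs`), hence killed by its order `n ≥ 1`, and `T_ℓ f` is injective
   (`IsIsogeny.tateModuleMap_injective`, same file);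
3. pure algebra on Tate modules (`TateModule.exists_map_eq_nsmul_of_surjective`): if `f : M → N`
   is a surjective additive map whose kernel is killed by `n`, then `n • T_p N ⊆ T_p f (T_p M)`
   (lift `b = (b_i)` to `a_i := n • s(b_i)` for any set-theoretic section `s` of `f`; the
   corrections lie in `ker f` and are killed by `n`);
4. hence `V_p f = ℚ_p ⊗ T_p f` is **bijective**
   (`TateModule.bijective_baseChange_map_of_surjective`): injective because `ℚ_p` is flat over
   `ℤ_p` (a localisation, Mathlib `IsLocalization.flat`), surjective because
   `c ⊗ b = (c/n) ⊗ T_p f(a)`;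
5. the `ℚ_ℓ`-linear bijection `V_ℓ f` is `Γ_K`-equivariant (`tateModuleMap_smul`, base-changed),
   so `LinearEquiv.ofBijective` upgrades to a `Representation.Equiv` (Mathlib
   `Representation.Equiv.mk`).

No hypothesis `ℓ ≠ char K` is needed (and the named fact has none): the argument works for every
prime `ℓ`.

## Design notes

* Pure theorems, no new definitions and no new named facts (D-0026); the fact is discharged as
  stated.
* Mathlib searched and used: `AlgebraicGeometry.pointOfClosedPoint` / `pointOfClosedPoint_comp`
  (`AlgClosed/Basic`: closed points of a scheme locally of finite type over an algebraically
  closed field are rational), `IsClosed.exists_closed_singleton`,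
  `QuasiCompact.compactSpace_of_compactSpace`, the `Surjective`/`IsFinite` instances for
  `pullback.snd`, `IsLocalization.flat`, `Module.Flat.lTensor_preserves_injective_linearMap`,
  `LinearMap.baseChange_comp`, `LinearEquiv.ofBijective`, `Representation.Equiv.mk`. Mathlib has
  no Tate modules / isogenies of abelian varieties.

## References

* J. Tate, *Endomorphisms of abelian varieties over finite fields*, Invent. Math. 2 (1966),
  134–144, §1 (the functor `V_ℓ` on abelian varieties up to isogeny). Not held by the literature
  store (paywalled; acquisition requested); locator as vendored in `AVIsogenyTate.lean`.
  [Tate1966Endomorphisms]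
* D. Mumford, *Abelian Varieties*, TIFR Studies in Math. 5 (1970), §19, p. 172 (`V_ℓ f` is an
  isomorphism for an isogeny `f`) and Remark p. 169. Not held; locator as vendored.
  [MumfordAV1970]
* J. S. Milne, *Abelian Varieties*, Ch. V of Cornell–Silverman (eds.), *Arithmetic Geometry*,
  Springer (1986): §8 (isogenies; p. 115 = PDF p. 181: `n_A = g ∘ f`), Remark 8.4 (PDF p. 182),
  proof of Prop. 16.8 (p. 138 = PDF p. 204). Read in the held copy
  `book:cornellnd-arithmetic-geometry`. [Milne1986AbelianVarieties]
* U. Görtz, T. Wedhorn, *Algebraic Geometry I* (2nd ed., 2020), §(5.1), first paragraphs (over an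
  algebraically closed field the closed points of a scheme locally of finite type are the
  rational points; read in the held copy, PDF p. 149). [GortzWedhorn2020]
-/

universe u v

open CategoryTheory AlgebraicGeometry Limits
open scoped TensorProduct

noncomputable section

namespace Literature.NumberTheory.DiophantineGeometry

/-! ### Points of finite surjective morphisms over an algebraically closed field -/

section FiniteMorphisms

variable {X Y : Scheme.{u}} {Ω : Type u} [Field Ω] [IsAlgClosed Ω]

/-- **`Ω`-points lift along finite surjective morphisms** (`Ω` algebraically closed): if
`φ : X → Y` is a finite surjective morphism of schemes and `q : Spec Ω → Y`, there is
`P : Spec Ω → X` with `P ≫ φ = q`. Proof: the fibre `X ×_Y Spec Ω → Spec Ω` is finite (base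
change) and surjective (base change of a surjective morphism), so the fibre is a non-empty
quasi-compact `T₀` space and has a closed point; a closed point of a scheme locally of finite type
over the algebraically closed field `Ω` is an `Ω`-rational point (Hilbert's Nullstellensatz;
Mathlib `AlgebraicGeometry.pointOfClosedPoint`), i.e. a section of the fibre, whose composite with
the first projection is the required lift. Görtz–Wedhorn, *Algebraic Geometry I*, §(5.1) (closed
points of a scheme locally of finite type over an algebraically closed field are rational) with
Prop. 4.8 / Remark 4.9 (surjectivity and points with values in fields). [folklore] -/
theorem exists_specHom_comp_eq_of_isFinite (φ : X ⟶ Y) [IsFinite φ] [Surjective φ]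
    (q : Spec (.of Ω) ⟶ Y) : ∃ P : Spec (.of Ω) ⟶ X, P ≫ φ = q := by
  haveI : CompactSpace ↥(Spec (.of Ω)) := inferInstanceAs (CompactSpace (PrimeSpectrum Ω))
  haveI : CompactSpace ↥(pullback φ q) :=
    QuasiCompact.compactSpace_of_compactSpace (pullback.snd φ q)
  -- the fibre is non-empty, hence has a closed point
  have hne : (Set.univ : Set ↥(pullback φ q)).Nonempty := by
    obtain ⟨x, -⟩ := (pullback.snd φ q).surjective (IsLocalRing.closedPoint Ω)
    exact ⟨x, trivial⟩
  obtain ⟨x, -, hx⟩ := isClosed_univ.exists_closed_singleton hne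
  -- which is `Ω`-rational: a section of the fibre
  refine ⟨pointOfClosedPoint (pullback.snd φ q) x hx ≫ pullback.fst φ q, ?_⟩
  rw [Category.assoc, pullback.condition, pointOfClosedPoint_comp_assoc]

end FiniteMorphisms

/-! ### Tate modules of surjective maps with bounded-torsion kernel -/

section TateModule

open Literature.NumberTheory.EllipticCurves (TateModule)
open Literature.NumberTheory.EllipticCurves.TateModule

variable {M : Type u} [AddCommGroup M] {N : Type v} [AddCommGroup N] (p : ℕ) [Fact p.Prime]

/-- **The cokernel of `T_p f` is killed by `n`** when `f : M → N` is a surjective additive map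
whose kernel is killed by `n`: for every `b ∈ T_p N` there is `a ∈ T_p M` with `T_p f (a) = n • b`.
Take `a_i := n • s(b_i)` for any set-theoretic section `s` of `f`; the defects
`p^i • s(b_i)` and `p • s(b_{i+1}) - s(b_i)` lie in `ker f`, so they are killed by `n`, which makes
`(a_i)` a compatible sequence, and `f(a_i) = n • b_i`. This is the computation "for `b ∈ T_ℓ B`
there is `a ∈ T_ℓ A` with `ℓ^m b = f(a)`" of Milne, *Abelian Varieties* (1986), proof of
Prop. 16.8 (PDF p. 204), for an isogeny `f`. Deliberate dot-notation extension of
`Literature.NumberTheory.EllipticCurves.TateModule` (generic Tate-module algebra).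
[cite: Milne1986AbelianVarieties, proof of Prop. 16.8 (p. 138)] -/
theorem _root_.Literature.NumberTheory.EllipticCurves.TateModule.exists_map_eq_nsmul_of_surjective
    {f : M →+ N} (hf : Function.Surjective f) {n : ℕ} (hker : ∀ x, f x = 0 → n • x = 0)
    (b : TateModule N p) : ∃ a : TateModule M p, map p f a = n • b := by
  refine ⟨TateModule.mk (fun i => n • Function.surjInv hf (proj p i b))
    (fun i => ?_) (fun i => ?_), ?_⟩
  · rw [smul_comm]
    apply hker
    rw [map_nsmul, Function.surjInv_eq hf, pow_smul_proj]
  · rw [smul_comm, ← sub_eq_zero, ← smul_sub]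
    apply hker
    rw [map_sub, map_nsmul, Function.surjInv_eq hf, Function.surjInv_eq hf, smul_proj_succ,
      sub_self]
  · exact TateModule.ext fun i => by simp [Function.surjInv_eq hf, map_nsmul]

/-- **`V_p f = ℚ_p ⊗ T_p f` is bijective** for a surjective additive map `f : M → N` with finite
kernel: `T_p f` is injective (`TateModule.map_injective_of_finite_ker`) and stays injective after
the flat base change `ℤ_p → ℚ_p` (a localisation), and it is surjective up to the order `n` of
`ker f` (`exists_map_eq_nsmul_of_surjective`), which is invertible in `ℚ_p`:
`c ⊗ b = (c / n) ⊗ T_p f (a)`. For `f` an isogeny of abelian varieties this is "`V_ℓ f` is an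
isomorphism", Mumford, *Abelian Varieties*, §19, p. 172; Milne 1986, §8 and proof of Prop. 16.8.
Deliberate dot-notation extension of `Literature.NumberTheory.EllipticCurves.TateModule`.
[cite: MumfordAV1970, §19 p. 172] -/
theorem _root_.Literature.NumberTheory.EllipticCurves.TateModule.bijective_baseChange_map_of_surjective
    (f : M →+ N) (hfk : (f.ker : Set M).Finite) (hf : Function.Surjective f) :
    Function.Bijective ((map p f).baseChange ℚ_[p]) := by
  haveI : Module.Flat ℤ_[p] ℚ_[p] := IsLocalization.flat ℚ_[p] (nonZeroDivisors ℤ_[p])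
  -- the kernel is killed by its order `n ≥ 1`
  haveI : Finite f.ker := hfk.to_subtype
  have hn : 0 < Nat.card f.ker := Nat.card_pos
  have hker : ∀ x, f x = 0 → Nat.card f.ker • x = 0 := fun x hx => by
    simpa using congrArg Subtype.val (card_nsmul_eq_zero' (x := (⟨x, hx⟩ : f.ker)))
  constructor
  · rw [LinearMap.baseChange_eq_ltensor]
    exact Module.Flat.lTensor_preserves_injective_linearMap _ (map_injective_of_finite_ker f hfk)
  · intro z
    induction z using TensorProduct.induction_on with
    | zero => exact ⟨0, map_zero _⟩
    | tmul c b =>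
      obtain ⟨a, ha⟩ := exists_map_eq_nsmul_of_surjective p hf hker b
      have hn0 : (Nat.card f.ker : ℚ_[p]) ≠ 0 := Nat.cast_ne_zero.mpr hn.ne'
      have hc : ((Nat.card f.ker : ℤ_[p]) • (c / Nat.card f.ker) : ℚ_[p]) = c := by
        rw [Algebra.smul_def, map_natCast, ← mul_div_assoc, mul_div_cancel_left₀ _ hn0]
      refine ⟨(c / Nat.card f.ker) ⊗ₜ a, ?_⟩
      rw [LinearMap.baseChange_tmul, ha, ← Nat.cast_smul_eq_nsmul ℤ_[p] _ b,
        ← TensorProduct.smul_tmul, hc]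
    | add x y hx hy =>
      obtain ⟨x', rfl⟩ := hx
      obtain ⟨y', rfl⟩ := hy
      exact ⟨x' + y', map_add _ _ _⟩

end TateModule

/-! ### Isogenies: surjectivity on geometric points, `V_ℓ f` bijective, discharge -/

section AbelianVariety
open Literature.AlgebraicGeometry.Motives (AbelianVariety)
open Literature.AlgebraicGeometry.Motives.AbelianVariety
open Literature.AlgebraicGeometry.Motives.AbelianVariety.Hom

variable {K : Type u} [Field K] {A B : AbelianVariety K}

/-- **An isogeny is surjective on geometric points**: for an isogeny `f : A ⟶ B` of abelian
varieties over `K`, the map `geomPointsMap f : A(K̄) → B(K̄)` is surjective. The morphism of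
schemes underlying `f` is finite and surjective (definition of `IsIsogeny`), so every `K̄`-point
of `B` lifts to a `K̄`-point of `A` (`exists_specHom_comp_eq_of_isFinite`); the lift is a point
over `K` because `f` is a `K`-morphism. Milne, *Abelian Varieties* (1986), §8: an isogeny is a
surjective homomorphism with finite kernel (Prop. 8.1; on `k̄`-points, Remark 8.4); Mumford §4
and §19. [cite: Milne1986AbelianVarieties, §8 Prop. 8.1] -/
theorem _root_.Literature.AlgebraicGeometry.Motives.AbelianVariety.IsIsogeny.geomPointsMap_surjective
    {f : A ⟶ B} (hf : IsIsogeny f) : Function.Surjective (geomPointsMap f) := by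
  obtain ⟨_, _⟩ := hf
  intro y
  obtain ⟨P₀, hP₀⟩ := exists_specHom_comp_eq_of_isFinite (Hom.toSchemeHom f)
    (Literature.AlgebraicGeometry.Motives.AlgPoints.toSpecHom (Additive.toMul y))
  -- the lift is a `K̄`-point of `A` over `K`
  have w : P₀ ≫ A.X.hom =
      (Literature.AlgebraicGeometry.Motives.specOver K (AlgebraicClosure K)).hom := by
    rw [← Over.w f.hom.hom.hom, ← Category.assoc]
    erw [hP₀]
    exact Over.w (Additive.toMul y)
  refine ⟨Additive.ofMul (Over.homMk P₀ w : A.Points (AlgebraicClosure K)), ?_⟩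
  rw [geomPointsMap_ofMul]
  change Additive.ofMul (Over.homMk P₀ w ≫ f.hom.hom.hom) = Additive.ofMul (Additive.toMul y)
  congr 1
  exact Over.OverMorphism.ext hP₀

/-- **`V_ℓ f` is bijective for an isogeny `f`**, for every prime `ℓ`: the `ℚ_ℓ`-linear map
`ℚ_ℓ ⊗ T_ℓ f : V_ℓ A → V_ℓ B` is a bijection, since `A(K̄) → B(K̄)` is surjective
(`IsIsogeny.geomPointsMap_surjective`) with finite kernel (`IsIsogeny.finite_ker_geomPointsMap`)
and `TateModule.bijective_baseChange_map_of_surjective` applies. Mumford, *Abelian Varieties*,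
§19, p. 172 ("`V_ℓ f` is an isomorphism"); Milne 1986, proof of Prop. 16.8.
[cite: MumfordAV1970, §19 p. 172] -/
theorem _root_.Literature.AlgebraicGeometry.Motives.AbelianVariety.IsIsogeny.bijective_baseChange_tateModuleMap
    {f : A ⟶ B} (hf : IsIsogeny f) (ℓ : ℕ) [Fact ℓ.Prime] :
    Function.Bijective ((tateModuleMap ℓ f).baseChange ℚ_[ℓ]) :=
  haveI := hf.finite_ker_geomPointsMap
  Literature.NumberTheory.EllipticCurves.TateModule.bijective_baseChange_map_of_surjective ℓ
    (geomPointsMap f) (Set.toFinite _) hf.geomPointsMap_surjective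

/-- **Discharge of the named fact `nonempty_equiv_rationalTateRep_of_isIsogenous`** (Tate 1966,
§1; Mumford, *Abelian Varieties*, §19, p. 172): isogenous abelian varieties `A, B` over a field
`K` have isomorphic rational Tate representations, `V_ℓ A ≅ V_ℓ B` as `ℚ_ℓ[Γ_K]`-modules, for
every prime `ℓ`. Given an isogeny `f : A ⟶ B`, the `ℚ_ℓ`-linear bijection
`V_ℓ f = ℚ_ℓ ⊗ T_ℓ f` (`IsIsogeny.bijective_baseChange_tateModuleMap`, Mathlib
`LinearEquiv.ofBijective`) commutes with `Γ_K` because `T_ℓ f` does (`tateModuleMap_smul`), so it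
is a `Representation.Equiv`. Stated with the named arguments `(A := A) (B := B)` (the fact's
variables are implicit). [cite: Tate1966Endomorphisms, §1] -/
theorem _root_.Literature.AlgebraicGeometry.Motives.AbelianVariety.nonempty_equiv_rationalTateRep_of_isIsogenous_holds :
    nonempty_equiv_rationalTateRep_of_isIsogenous (A := A) (B := B) := by
  intro h ℓ _
  obtain ⟨f, hf⟩ := h
  let e : A.rationalTateModule ℓ ≃ₗ[ℚ_[ℓ]] B.rationalTateModule ℓ :=
    LinearEquiv.ofBijective ((tateModuleMap ℓ f).baseChange ℚ_[ℓ])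
      (hf.bijective_baseChange_tateModuleMap ℓ)
  refine ⟨Representation.Equiv.mk e fun σ => ?_⟩
  -- equivariance: base change of `T_ℓ f ∘ ρ_A(σ) = ρ_B(σ) ∘ T_ℓ f`
  change ((tateModuleMap ℓ f).baseChange ℚ_[ℓ]) ∘ₗ ((A.tateRep ℓ σ).baseChange ℚ_[ℓ]) =
    ((B.tateRep ℓ σ).baseChange ℚ_[ℓ]) ∘ₗ ((tateModuleMap ℓ f).baseChange ℚ_[ℓ])
  rw [← LinearMap.baseChange_comp, ← LinearMap.baseChange_comp,
    show (tateModuleMap ℓ f) ∘ₗ (A.tateRep ℓ σ) = (B.tateRep ℓ σ) ∘ₗ (tateModuleMap ℓ f) from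
      LinearMap.ext fun x => tateModuleMap_smul f σ x]

end AbelianVariety

end Literature.NumberTheory.DiophantineGeometry
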